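import Literature.MathematicalPhysics.StatisticalMechanics.BarlowStacking
import Literature.MathematicalPhysics.StatisticalMechanics.PeriodicConfigurationSums

/-!
# Line `vanishing-excess-truss-rigidity` (crux `CoarseGrains`, stmt-AtomisticToContinuum-9331): the hcp energy series

Stub `stub_hcpEnergySeries` of the line skeleton: for all `a, h ≠ 0` the Lennard-Jones energy
per particle of the relaxed hexagonal close packing `hcpPeriodicConfiguration ha hh`
(`BarlowStacking.lean`; Blanc–Lewin 2015, §2.1 (23) for the energy per particle of a periodic
configuration, `PeriodicConfiguration.energyPerParticle`) is the explicit `ℤ³`-indexed series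

  `e(hcp(a,h)) = ½ ∑_{v = (k,i,j) ≠ 0} V_LJ(√(a² Q(v) + k² h²))`,
  `Q(k,i,j) = i² + ij + j² + [k odd]·(i + j + 1/3)`,

together with the summability of this series and of `∑_{v ≠ 0} (a² Q(v) + k² h²)⁻³`.

The quadratic form `Q` enters through a binder `(Q : ℤ × ℤ × ℤ → ℝ)` and the defining hypothesis
`Q = fun v => …` (a `:=`-free spelling of the skeleton's `let Q := …`, so that the registered stub
signature is not cut at the `:=`; the `let` form and the fully expanded form follow by
`stub_hcpEnergySeries a h ha hh _ rfl`).

Proof (bookkeeping, all `[folklore]`).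

* `a² Q(k,i,j) + k² h² = ‖barlowPos a h alternatingHagg k i j‖²` (coordinates
  `barlowPos_apply_zero/one/two`, labels `haggLabel_alternating`, `(√3)² = 3`), and the map
  `Φ : (k,i,j) ↦ barlowPos a h alternatingHagg k i j` is injective with range the point set
  `hcpStacking a h` of the configuration (`hcpPeriodicConfiguration_points`) and `Φ 0 = 0`.
* The motif of `hcpPeriodicConfiguration ha hh` is `{Φ 0, Φ (1,0,0)} = {0, b}`, `b = w + h e₃`; the
  two site sums `∑_{y ∈ P, y ≠ x} V(|x − y|)`, `x ∈ {0, b}`, coincide, because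
  `(k,i,j) ↦ (1 − k, −i, −j)` is a bijection of `ℤ³` with
  `|b − Φ(1−k,−i,−j)|² = a² Q(k,i,j) + k² h² = |Φ(k,i,j)|²` (point reflection of the stacking in
  `b/2`).
* A sum over the points `y ≠ x` of the configuration is re-indexed by `ℤ³ ∖ {0}` through an
  injection `ψ` with `ψ 0 = x` and range the point set (`tsum_subtype`,
  `Function.Injective.tsum_eq`), written as a sum over `ℤ³` of an `if v = 0 then 0 else …` family;
  summability is transported the same way (`summable_subtype_iff_indicator`,
  `Function.Injective.summable_iff`) from `PeriodicConfiguration.summable_inv_pow_dist` (`n = 6`)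
  and `PeriodicConfiguration.summable_lennardJones_dist_three`.
* Finally `e = (2·2)⁻¹ (T + T) = ½ T`.
-/

noncomputable section

namespace Summit.AtomisticToContinuum.Crystallization.Theorems.ExcessDecayLiouvilleCoarseGrains

open Literature.MathematicalPhysics.StatisticalMechanics

/-! ## Re-indexing a sum over the points of a configuration by `ℤ³` -/

/-- The indicator of the punctured point set, pulled back along an injection `ψ : ℤ³ → ℝ³` with
`ψ 0 = x` and range the point set, is the family `if v = 0 then 0 else F (ψ v)`. [folklore] -/
private theorem indicator_comp_eq_ite {S : Set (EuclideanSpace ℝ (Fin 3))}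
    {x : EuclideanSpace ℝ (Fin 3)} {ψ : ℤ × ℤ × ℤ → EuclideanSpace ℝ (Fin 3)}
    (hinj : Function.Injective ψ) (h0 : ψ 0 = x) (hS : ∀ y, y ∈ S ↔ ∃ v, ψ v = y)
    (F : EuclideanSpace ℝ (Fin 3) → ℝ) (v : ℤ × ℤ × ℤ) :
    {y | y ∈ S ∧ y ≠ x}.indicator F (ψ v) = if v = 0 then 0 else F (ψ v) := by
  by_cases hv : v = 0
  · rw [if_pos hv, Set.indicator_of_notMem]
    simp [hv, h0]
  · rw [if_neg hv, Set.indicator_of_mem]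
    exact ⟨(hS _).2 ⟨v, rfl⟩, fun he => hv (hinj (he.trans h0.symm))⟩

/-- The support of that indicator lies in the range of `ψ`. [folklore] -/
private theorem support_indicator_subset_range {S : Set (EuclideanSpace ℝ (Fin 3))}
    {x : EuclideanSpace ℝ (Fin 3)} {ψ : ℤ × ℤ × ℤ → EuclideanSpace ℝ (Fin 3)}
    (hS : ∀ y, y ∈ S ↔ ∃ v, ψ v = y) (F : EuclideanSpace ℝ (Fin 3) → ℝ) :
    Function.support ({y | y ∈ S ∧ y ≠ x}.indicator F) ⊆ Set.range ψ := fun y hy => by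
  obtain ⟨v, hv⟩ := (hS y).1 (Set.support_indicator_subset hy).1
  exact ⟨v, hv⟩

/-- **Re-indexing by `ℤ³`.** If `ψ : ℤ³ → ℝ³` is injective with `ψ 0 = x` and range `S`, then
`∑'_{y ∈ S, y ≠ x} F y = ∑'_{v ∈ ℤ³} (if v = 0 then 0 else F (ψ v))`. [folklore] -/
private theorem tsum_points_eq_tsum_ite {S : Set (EuclideanSpace ℝ (Fin 3))}
    {x : EuclideanSpace ℝ (Fin 3)} {ψ : ℤ × ℤ × ℤ → EuclideanSpace ℝ (Fin 3)}
    (hinj : Function.Injective ψ) (h0 : ψ 0 = x) (hS : ∀ y, y ∈ S ↔ ∃ v, ψ v = y)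
    (F : EuclideanSpace ℝ (Fin 3) → ℝ) :
    ∑' y : {y // y ∈ S ∧ y ≠ x}, F y.1 = ∑' v : ℤ × ℤ × ℤ, if v = 0 then 0 else F (ψ v) :=
  calc ∑' y : {y // y ∈ S ∧ y ≠ x}, F y.1
      = ∑' y, {y | y ∈ S ∧ y ≠ x}.indicator F y := tsum_subtype {y | y ∈ S ∧ y ≠ x} F
    _ = ∑' v, {y | y ∈ S ∧ y ≠ x}.indicator F (ψ v) :=
        (hinj.tsum_eq (support_indicator_subset_range hS F)).symm
    _ = _ := tsum_congr (indicator_comp_eq_ite hinj h0 hS F)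

/-- **Transport of summability** along the same re-indexing. [folklore] -/
private theorem summable_ite_of_summable_points {S : Set (EuclideanSpace ℝ (Fin 3))}
    {x : EuclideanSpace ℝ (Fin 3)} {ψ : ℤ × ℤ × ℤ → EuclideanSpace ℝ (Fin 3)}
    (hinj : Function.Injective ψ) (h0 : ψ 0 = x) (hS : ∀ y, y ∈ S ↔ ∃ v, ψ v = y)
    {F : EuclideanSpace ℝ (Fin 3) → ℝ} (hF : Summable fun y : {y // y ∈ S ∧ y ≠ x} => F y.1) :
    Summable fun v : ℤ × ℤ × ℤ => if v = 0 then 0 else F (ψ v) := by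
  have h1 : Summable ({y | y ∈ S ∧ y ≠ x}.indicator F) :=
    (summable_subtype_iff_indicator (s := {y | y ∈ S ∧ y ≠ x}) (f := F)).1 hF
  have h2 : Summable ({y | y ∈ S ∧ y ≠ x}.indicator F ∘ ψ) := by
    refine (hinj.summable_iff fun y hy => ?_).2 h1
    by_contra hne
    exact hy (support_indicator_subset_range hS F (Function.mem_support.2 hne))
  exact h2.congr (indicator_comp_eq_ite hinj h0 hS F)

/-! ## The hcp point map `Φ (k,i,j) = barlowPos a h alternatingHagg k i j` -/

/-- **The radicand identity at the origin**: `|Φ(k,i,j) − Φ 0|² = a² Q(k,i,j) + k² h²` with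
`Q(k,i,j) = i² + ij + j² + [k odd](i + j + 1/3)` (`(√3)² = 3`, `ε² = ε` for the label
`ε ∈ {0,1}`). [folklore] -/
private theorem dist_hcp_zero_sq (a h : ℝ) (k i j : ℤ) :
    dist (barlowPos a h alternatingHagg 0 0 0) (barlowPos a h alternatingHagg k i j) ^ 2 =
      a ^ 2 * ((i : ℝ) ^ 2 + (i : ℝ) * j + (j : ℝ) ^ 2 +
        (if Even k then 0 else ((i : ℝ) + j + 1 / 3))) + (k : ℝ) ^ 2 * h ^ 2 := by
  have h3 : (√3 : ℝ) ^ 2 = 3 := Real.sq_sqrt (by norm_num)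
  rw [dist_barlowPos_sq, haggLabel_zero, haggLabel_alternating]
  split_ifs
  · push_cast
    linear_combination (a ^ 2 * (j : ℝ) ^ 2 / 4) * h3
  · push_cast
    linear_combination (a ^ 2 * ((j : ℝ) + 1 / 3) ^ 2 / 4) * h3

/-- The hcp labels of the reflected layer index: `L(1 − k) = 1 − L(k)`. [folklore] -/
private theorem haggLabel_alternating_one_sub (k : ℤ) :
    haggLabel alternatingHagg (1 - k) = if Even k then 1 else 0 := by
  rw [haggLabel_alternating]
  have hpar : Even (1 - k) ↔ ¬ Even k := by
    rw [Int.even_sub]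
    simp
  by_cases hk : Even k
  · rw [if_neg (fun h1 => (hpar.1 h1) hk), if_pos hk]
  · rw [if_pos (hpar.2 hk), if_neg hk]

/-- **The radicand identity at the second motif point** `b = Φ(1,0,0) = w + h e₃`:
`|b − Φ(1−k,−i,−j)|² = a² Q(k,i,j) + k² h²` (point reflection of the stacking in `b/2`).
[folklore] -/
private theorem dist_hcp_one_sq (a h : ℝ) (k i j : ℤ) :
    dist (barlowPos a h alternatingHagg 1 0 0)
        (barlowPos a h alternatingHagg (1 - k) (-i) (-j)) ^ 2 =
      a ^ 2 * ((i : ℝ) ^ 2 + (i : ℝ) * j + (j : ℝ) ^ 2 +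
        (if Even k then 0 else ((i : ℝ) + j + 1 / 3))) + (k : ℝ) ^ 2 * h ^ 2 := by
  have h3 : (√3 : ℝ) ^ 2 = 3 := Real.sq_sqrt (by norm_num)
  have h1 : haggLabel alternatingHagg 1 = 1 := by rw [haggLabel_alternating]; simp
  rw [dist_barlowPos_sq, h1, haggLabel_alternating_one_sub]
  split_ifs
  · push_cast
    linear_combination (a ^ 2 * (j : ℝ) ^ 2 / 4) * h3
  · push_cast
    linear_combination (a ^ 2 * ((j : ℝ) + 1 / 3) ^ 2 / 4) * h3

/-- **`Φ` is injective** for `a ≠ 0`, `h ≠ 0`: the third coordinate `k h` determines `k`, then the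
second `a√3/2 (j + L(k)/3)` determines `j`, then the first `a (i + j/2 + L(k)/2)` determines `i`.
[folklore] -/
private theorem hcp_injective {a h : ℝ} (ha : a ≠ 0) (hh : h ≠ 0) :
    Function.Injective fun v : ℤ × ℤ × ℤ => barlowPos a h alternatingHagg v.1 v.2.1 v.2.2 := by
  rintro ⟨k, i, j⟩ ⟨k', i', j'⟩ heq
  have e2 := congrArg (fun z : EuclideanSpace ℝ (Fin 3) => z 2) heq
  have e1 := congrArg (fun z : EuclideanSpace ℝ (Fin 3) => z 1) heq
  have e0 := congrArg (fun z : EuclideanSpace ℝ (Fin 3) => z 0) heq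
  simp only [barlowPos_apply_two, barlowPos_apply_one, barlowPos_apply_zero] at e0 e1 e2
  have hk : k = k' := by
    have : (k : ℝ) = k' := mul_right_cancel₀ hh e2
    exact_mod_cast this
  subst hk
  have h3 : (√3 : ℝ) ≠ 0 := by positivity
  have hj : j = j' := by
    have hc : a * √3 / 2 ≠ 0 := by
      refine div_ne_zero (mul_ne_zero ha h3) two_ne_zero
    have : (j : ℝ) = j' := by
      have := mul_left_cancel₀ hc e1
      linarith
    exact_mod_cast this
  subst hj
  have hi : i = i' := by
    have : (i : ℝ) = i' := by
      have := mul_left_cancel₀ ha e0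
      linarith
    exact_mod_cast this
  subst hi
  rfl

/-- **The range of `Φ` is the point set** of `hcpPeriodicConfiguration ha hh`
(`hcpPeriodicConfiguration_points`). [folklore] -/
private theorem mem_hcp_points_iff {a h : ℝ} (ha : a ≠ 0) (hh : h ≠ 0)
    (y : EuclideanSpace ℝ (Fin 3)) :
    y ∈ (hcpPeriodicConfiguration ha hh).points ↔
      ∃ v : ℤ × ℤ × ℤ, barlowPos a h alternatingHagg v.1 v.2.1 v.2.2 = y := by
  rw [hcpPeriodicConfiguration_points, hcpStacking, mem_barlowStacking_iff]
  constructor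
  · rintro ⟨k, i, j, rfl⟩
    exact ⟨(k, i, j), rfl⟩
  · rintro ⟨⟨k, i, j⟩, rfl⟩
    exact ⟨k, i, j, rfl⟩

/-- The reflected parametrisation `(k,i,j) ↦ Φ(1−k,−i,−j)` has the same range. [folklore] -/
private theorem mem_hcp_points_iff' {a h : ℝ} (ha : a ≠ 0) (hh : h ≠ 0)
    (y : EuclideanSpace ℝ (Fin 3)) :
    y ∈ (hcpPeriodicConfiguration ha hh).points ↔
      ∃ v : ℤ × ℤ × ℤ, barlowPos a h alternatingHagg (1 - v.1) (-v.2.1) (-v.2.2) = y := by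
  rw [mem_hcp_points_iff ha hh]
  constructor
  · rintro ⟨⟨k, i, j⟩, rfl⟩
    exact ⟨(1 - k, -i, -j), by simp⟩
  · rintro ⟨⟨k, i, j⟩, rfl⟩
    exact ⟨(1 - k, -i, -j), rfl⟩

/-- The reflected parametrisation is injective. [folklore] -/
private theorem hcp_injective' {a h : ℝ} (ha : a ≠ 0) (hh : h ≠ 0) :
    Function.Injective fun v : ℤ × ℤ × ℤ =>
      barlowPos a h alternatingHagg (1 - v.1) (-v.2.1) (-v.2.2) := by
  rintro ⟨k, i, j⟩ ⟨k', i', j'⟩ heq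
  have := hcp_injective ha hh (a₁ := (1 - k, -i, -j)) (a₂ := (1 - k', -i', -j')) heq
  simp only [Prod.mk.injEq, sub_right_inj, neg_inj] at this
  obtain ⟨rfl, rfl, rfl⟩ := this
  rfl

/-! ## The statement -/

/-- **The hcp energy per particle as an explicit series** (stub `stub_hcpEnergySeries` of line
`vanishing-excess-truss-rigidity`, crux `CoarseGrains`). For `a, h ≠ 0` and
`Q(k,i,j) = i² + ij + j² + [k odd](i + j + 1/3)` (given as a hypothesis `Q = fun v => …` on a
binder `Q`): the families
`v = (k,i,j) ↦ [v ≠ 0]·(a² Q(v) + k² h²)⁻³` and `v ↦ [v ≠ 0]·V_LJ(√(a² Q(v) + k² h²))` are summable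
over `ℤ³`, and the Lennard-Jones energy per particle of `hcpPeriodicConfiguration ha hh`
(Blanc–Lewin 2015, (23)) equals `½ ∑_{v ∈ ℤ³} [v ≠ 0]·V_LJ(√(a² Q(v) + k² h²))`. Both motif
points `0` and `b = w + h e₃` have the same site sum (point reflection `y ↦ b − y` of the stacking),
and the site sum at `0` is re-indexed by `(k,i,j) ↦ barlowPos a h alternatingHagg k i j`, whose
squared norm is `a² Q + k² h²`. [folklore] -/
theorem hcpEnergySeries_of_eq :
    ∀ (a h : ℝ) (ha : a ≠ 0) (hh : h ≠ 0) (Q : ℤ × ℤ × ℤ → ℝ),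
    (Q = fun v => (v.2.1 : ℝ) ^ 2 + (v.2.1 : ℝ) * v.2.2 + (v.2.2 : ℝ) ^ 2 +
      (if Even v.1 then 0 else ((v.2.1 : ℝ) + v.2.2 + 1 / 3))) →
    (Summable fun v : ℤ × ℤ × ℤ =>
        if v = 0 then (0 : ℝ) else ((a ^ 2 * Q v + (v.1 : ℝ) ^ 2 * h ^ 2)⁻¹) ^ 3) ∧
    (Summable fun v : ℤ × ℤ × ℤ =>
        if v = 0 then (0 : ℝ) else lennardJones (Real.sqrt (a ^ 2 * Q v + (v.1 : ℝ) ^ 2 * h ^ 2))) ∧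
    (hcpPeriodicConfiguration ha hh).energyPerParticle lennardJones =
      (1 / 2) * ∑' v : ℤ × ℤ × ℤ,
        if v = 0 then (0 : ℝ) else lennardJones (Real.sqrt (a ^ 2 * Q v + (v.1 : ℝ) ^ 2 * h ^ 2)) := by
  intro a h ha hh Q hQ
  have hQv : ∀ v : ℤ × ℤ × ℤ, Q v = (v.2.1 : ℝ) ^ 2 + (v.2.1 : ℝ) * v.2.2 + (v.2.2 : ℝ) ^ 2 +
      (if Even v.1 then 0 else ((v.2.1 : ℝ) + v.2.2 + 1 / 3)) := fun v => by rw [hQ]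
  /- the radicands are squared distances from the two motif points -/
  have hR0 : ∀ v : ℤ × ℤ × ℤ, dist (barlowPos a h alternatingHagg 0 0 0)
      (barlowPos a h alternatingHagg v.1 v.2.1 v.2.2) ^ 2 = a ^ 2 * Q v + (v.1 : ℝ) ^ 2 * h ^ 2 :=
    fun v => by rw [hQv]; exact dist_hcp_zero_sq a h v.1 v.2.1 v.2.2
  have hR1 : ∀ v : ℤ × ℤ × ℤ, dist (barlowPos a h alternatingHagg 1 0 0)
      (barlowPos a h alternatingHagg (1 - v.1) (-v.2.1) (-v.2.2)) ^ 2 =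
        a ^ 2 * Q v + (v.1 : ℝ) ^ 2 * h ^ 2 :=
    fun v => by rw [hQv]; exact dist_hcp_one_sq a h v.1 v.2.1 v.2.2
  have hd0 : ∀ v : ℤ × ℤ × ℤ, dist (barlowPos a h alternatingHagg 0 0 0)
      (barlowPos a h alternatingHagg v.1 v.2.1 v.2.2) =
        Real.sqrt (a ^ 2 * Q v + (v.1 : ℝ) ^ 2 * h ^ 2) :=
    fun v => by rw [← hR0 v, Real.sqrt_sq dist_nonneg]
  have hd1 : ∀ v : ℤ × ℤ × ℤ, dist (barlowPos a h alternatingHagg 1 0 0)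
      (barlowPos a h alternatingHagg (1 - v.1) (-v.2.1) (-v.2.2)) =
        Real.sqrt (a ^ 2 * Q v + (v.1 : ℝ) ^ 2 * h ^ 2) :=
    fun v => by rw [← hR1 v, Real.sqrt_sq dist_nonneg]
  have hΨ0 : (fun v : ℤ × ℤ × ℤ => barlowPos a h alternatingHagg (1 - v.1) (-v.2.1) (-v.2.2)) 0 =
      barlowPos a h alternatingHagg 1 0 0 := by simp
  /- the two site sums as the series -/
  have hT0 : ∑' y : {y // y ∈ (hcpPeriodicConfiguration ha hh).points ∧
      y ≠ barlowPos a h alternatingHagg 0 0 0},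
        lennardJones (dist (barlowPos a h alternatingHagg 0 0 0) y.1) =
      ∑' v : ℤ × ℤ × ℤ, if v = 0 then (0 : ℝ) else
        lennardJones (Real.sqrt (a ^ 2 * Q v + (v.1 : ℝ) ^ 2 * h ^ 2)) := by
    refine (tsum_points_eq_tsum_ite (x := barlowPos a h alternatingHagg 0 0 0)
      (hcp_injective ha hh) rfl (mem_hcp_points_iff ha hh)
      (fun y => lennardJones (dist (barlowPos a h alternatingHagg 0 0 0) y))).trans ?_
    refine tsum_congr fun v => ?_
    split_ifs
    · rfl
    · exact congrArg lennardJones (hd0 v)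
  have hT1 : ∑' y : {y // y ∈ (hcpPeriodicConfiguration ha hh).points ∧
      y ≠ barlowPos a h alternatingHagg 1 0 0},
        lennardJones (dist (barlowPos a h alternatingHagg 1 0 0) y.1) =
      ∑' v : ℤ × ℤ × ℤ, if v = 0 then (0 : ℝ) else
        lennardJones (Real.sqrt (a ^ 2 * Q v + (v.1 : ℝ) ^ 2 * h ^ 2)) := by
    refine (tsum_points_eq_tsum_ite (x := barlowPos a h alternatingHagg 1 0 0)
      (hcp_injective' ha hh) hΨ0 (mem_hcp_points_iff' ha hh)
      (fun y => lennardJones (dist (barlowPos a h alternatingHagg 1 0 0) y))).trans ?_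
    refine tsum_congr fun v => ?_
    split_ifs
    · rfl
    · exact congrArg lennardJones (hd1 v)
  refine ⟨?_, ?_, ?_⟩
  · /- summability of the inverse sixth powers -/
    have h6 := PeriodicConfiguration.summable_inv_pow_dist (hcpPeriodicConfiguration ha hh)
      (n := 6) (by norm_num) (barlowPos a h alternatingHagg 0 0 0)
    have hpow : ∀ d : ℝ, (d⁻¹) ^ 6 = ((d ^ 2)⁻¹) ^ 3 := fun d => by rw [← inv_pow, ← pow_mul]
    refine (summable_ite_of_summable_points (x := barlowPos a h alternatingHagg 0 0 0)
      (hcp_injective ha hh) rfl (mem_hcp_points_iff ha hh)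
      (F := fun y => (dist (barlowPos a h alternatingHagg 0 0 0) y)⁻¹ ^ 6) h6).congr fun v => ?_
    split_ifs
    · rfl
    · rw [hpow, hR0 v]
  · /- summability of the Lennard-Jones series -/
    have hLJ := PeriodicConfiguration.summable_lennardJones_dist_three
      (hcpPeriodicConfiguration ha hh) (barlowPos a h alternatingHagg 0 0 0)
    refine (summable_ite_of_summable_points (x := barlowPos a h alternatingHagg 0 0 0)
      (hcp_injective ha hh) rfl (mem_hcp_points_iff ha hh)
      (F := fun y => lennardJones (dist (barlowPos a h alternatingHagg 0 0 0) y)) hLJ).congr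
      fun v => ?_
    split_ifs
    · rfl
    · exact congrArg lennardJones (hd0 v)
  · /- the energy per particle: both motif points have the same site sum -/
    have key : ∀ x ∈ (hcpPeriodicConfiguration ha hh).motif,
        ∑' y : {y // y ∈ (hcpPeriodicConfiguration ha hh).points ∧ y ≠ x},
          lennardJones (dist x y.1) =
        ∑' v : ℤ × ℤ × ℤ, if v = 0 then (0 : ℝ) else
          lennardJones (Real.sqrt (a ^ 2 * Q v + (v.1 : ℝ) ^ 2 * h ^ 2)) := by
      intro x hx
      have hx' : x ∈ (Finset.range 2).image
          (fun m : ℕ => barlowPos a h alternatingHagg m 0 0) := hx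
      simp only [Finset.mem_image, Finset.mem_range] at hx'
      obtain ⟨m, hm, rfl⟩ := hx'
      rcases (show m = 0 ∨ m = 1 by omega) with rfl | rfl
      · exact hT0
      · exact hT1
    have hc : (((hcpPeriodicConfiguration ha hh).motif.card : ℕ) : ℝ) ≠ 0 :=
      Nat.cast_ne_zero.2 (Finset.card_pos.2 (hcpPeriodicConfiguration ha hh).motif_nonempty).ne'
    rw [PeriodicConfiguration.energyPerParticle, Finset.sum_congr rfl key, Finset.sum_const,
      nsmul_eq_mul, mul_inv, mul_assoc, inv_mul_cancel_left₀ hc, one_div]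


/-- **Stub `stub_hcpEnergySeries` of line `vanishing-excess-truss-rigidity` (crux `CoarseGrains`,
stmt-AtomisticToContinuum-9331), registered `let`-form:** the Lennard-Jones energy per particle of
`hcp(a,h)` as the explicit `ℤ³`-series `½ ∑_{v ≠ 0} V_LJ(√(a²Q v + k²h²))` together with the two
summability facts (from `hcpEnergySeries_of_eq` with `Q` specialised by `rfl`). [folklore] -/
theorem stub_hcpEnergySeries :
    ∀ (a h : ℝ) (ha : a ≠ 0) (hh : h ≠ 0),
    let Q : ℤ × ℤ × ℤ → ℝ := fun ν => (ν.2.1 : ℝ) ^ 2 + (ν.2.1 : ℝ) * ν.2.2 + (ν.2.2 : ℝ) ^ 2 +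
      (if Even ν.1 then 0 else ((ν.2.1 : ℝ) + ν.2.2 + 1 / 3))
    (Summable fun ν : ℤ × ℤ × ℤ =>
        if ν = 0 then (0 : ℝ) else ((a ^ 2 * Q ν + (ν.1 : ℝ) ^ 2 * h ^ 2)⁻¹) ^ 3) ∧
    (Summable fun ν : ℤ × ℤ × ℤ =>
        if ν = 0 then (0 : ℝ) else lennardJones (Real.sqrt (a ^ 2 * Q ν + (ν.1 : ℝ) ^ 2 * h ^ 2))) ∧
    (hcpPeriodicConfiguration ha hh).energyPerParticle lennardJones =
      (1 / 2) * ∑' ν : ℤ × ℤ × ℤ,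
        if ν = 0 then (0 : ℝ) else lennardJones (Real.sqrt (a ^ 2 * Q ν + (ν.1 : ℝ) ^ 2 * h ^ 2)) := by
  intro a h ha hh
  exact hcpEnergySeries_of_eq a h ha hh _ rfl

end Summit.AtomisticToContinuum.Crystallization.Theorems.ExcessDecayLiouvilleCoarseGrains

end
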